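import Literature.AlgebraicGeometry.HodgeTheory.CrossProductsGenericDivisibility
import Literature.AlgebraicGeometry.HodgeTheory.CurveIntegralCohomologyGradedBasis
import Summits.HodgeConjecture.HodgeConjecture.Theorems.GenericDivisibilityHodgeClassesGenericallyDivisibleAboveDim

/-!
# Route GenericDivisibility — crux `HodgeClassesGenericallyDivisible` (C1, item stmt-HodgeConjecture-18466):
# the odd-degree descent for `Y ⊗ C`, `C` a curve (crux-triage r2 harvest `PontryaginOddDescent`, product form)

For `Y` a smooth projective complex `(2p-1)`-fold and `C` a smooth projective curve, the crux C1 on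
the `2p`-fold `X = Y ⊗ C` — for EVERY integral class `z ∈ H²ᵖ(X(ℂ); ℤ)`, Hodge type not used — is
implied by the ODD-DEGREE statement on `Y`: "every `w ∈ H²ᵖ⁻¹(Y(ℂ); ℤ)` is divisible by `m` on the
complex points of a non-empty Zariski open of `Y`, for every `m ≥ 1`". Proof: `H*(C(ℂ); ℤ)` is free
with a graded basis in degrees `0, 1, 2` (`HodgeTheory/CurveIntegralCohomologyGradedBasis`:
orientation, Poincaré duality, universal coefficients), so by the integral Künneth theorem
`z = Σⱼ pr_Y^* aⱼ ⌣ pr_C^* vⱼ` (`exists_eq_sum_cross_tensor`); the coefficients of the degree-`0`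
classes lie in `H²ᵖ(Y(ℂ); ℤ)` and die generically (`2p > dim Y`: Andreotti–Frankel,
`stub_aboveDimGenericallyZero_sharp`), the degree-`2` classes `vⱼ ∈ H²(C(ℂ); ℤ)` die on `C ∖ pt`
(same theorem), and the coefficients of the degree-`1` classes lie in `H²ᵖ⁻¹(Y(ℂ); ℤ)` — the
hypothesis; the product descent `exists_restrictToCompl_eq_nsmul_of_gradedBasis` assembles the
pieces on a product open of `Y ⊗ C`:

* `genericDivisibility_tensorCurve_of_oddDescent` — the descent, for any `k > dim Y` and `μ ∈ ℕ`;
* `stub_hodgeClassesGenericallyDivisible_tensorCurve_of_oddDescent` — the registered sub-goal of the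
  item: C1 for `X = Y ⊗ C` (all integral classes) granted odd-degree generic divisibility on `Y`.

This is the honest residual statement the crux-triage r2 panel isolated for product / C×Y-dominated
lines (odd-degree generic divisibility in degree `2p-1` on `Y`, a GHC-type statement, open for
`p ≥ 2`; for `p = 1` it FAILS — `H¹(Y(ℂ); ℤ)` is saturated in `H¹` of every open — consistently with
`Y ⊗ C` = product of curves, where C1 at `p = 1` holds for `(1,1)`-classes only). The crux itself is
untouched (open problem).

References: A. Hatcher, *Algebraic Topology* (2002), Thm. 3.16, Prop. 3.10, Thm. 3.30
[HatcherAT2002]; A. Andreotti, T. Frankel, Ann. of Math. 69 (1959), Thm. 1 [AndreottiFrankel1959];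
A. Grothendieck, Topology 8 (1969), §1 [GrothendieckTopology1969].
-/

set_option linter.dupNamespace false

noncomputable section

namespace Summit.HodgeConjecture.HodgeConjecture.Theorems

open CategoryTheory MonoidalCategory
open Literature.AlgebraicGeometry.Motives Literature.AlgebraicGeometry.HodgeTheory
  Literature.AlgebraicTopology.SingularHomology
open Summit.HodgeConjecture.HodgeConjecture.Theses.GenericDivisibility

/-- **Odd-degree descent for `Y ⊗ C`.** For `Y` smooth projective over `ℂ` of dimension `d`, `C` a
smooth projective curve, `k > d` and `μ ∈ ℕ`: if every class of `Hᵏ⁻¹(Y(ℂ); ℤ)` is divisible by `μ`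
on the complex points of a non-empty Zariski open of `Y`, then every class of `Hᵏ((Y ⊗ C)(ℂ); ℤ)` is
divisible by `μ` on the complex points of a non-empty Zariski open of `Y ⊗ C` (integral Künneth along
a graded basis of `H*(C(ℂ); ℤ)`; Andreotti–Frankel for the degree-`0` and degree-`2` pieces; product
descent). [cite: HatcherAT2002, §3.2 Thm. 3.16 and §3.1 Prop. 3.10] [cite: AndreottiFrankel1959, Thm. 1]
[cite: GrothendieckTopology1969, §1] -/
theorem genericDivisibility_tensorCurve_of_oddDescent {d : ℕ} {Y C : SchemeOver ℂ}
    (hY : IsSmoothProjective d Y) (hC : IsSmoothProjective 1 C) {k : ℕ} (hk : d < k) (μ : ℕ)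
    (hodd : ∀ w : singularCohomology ℤ ℤ (ComplexPoints Y) (k - 1),
      ∃ S : Set Y.left, IsClosed S ∧ S ≠ Set.univ ∧
        ∃ y : singularCohomology ℤ ℤ (complexPointsCompl Y S) (k - 1),
          restrictToCompl ℤ Y (k - 1) S w = μ • y)
    (z : singularCohomology ℤ ℤ (ComplexPoints (Y ⊗ C)) k) :
    ∃ Z : Set (Y ⊗ C).left, IsClosed Z ∧ Z ≠ Set.univ ∧
      ∃ w : singularCohomology ℤ ℤ (complexPointsCompl (Y ⊗ C) Z) k,
        restrictToCompl ℤ (Y ⊗ C) k Z z = μ • w := by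
  obtain ⟨σ, _, v, hv⟩ := exists_gradedBasis_int_complexPoints_curve hC
  -- degree by degree: `0` and `2` by Andreotti–Frankel, `1` by the hypothesis
  have hyp : ∀ j : (Σ k : Fin (2 + 1), σ k), ((j.1 : ℕ)) ≤ k →
      (∃ T : Set C.left, IsClosed T ∧ T ≠ Set.univ ∧
        restrictToCompl ℤ C (j.1 : ℕ) T (v j.1 j.2) = 0) ∨
      (∀ x : singularCohomology ℤ ℤ (ComplexPoints Y) (k - (j.1 : ℕ)),
        ∃ S : Set Y.left, IsClosed S ∧ S ≠ Set.univ ∧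
          ∃ y : singularCohomology ℤ ℤ (complexPointsCompl Y S) (k - (j.1 : ℕ)),
            restrictToCompl ℤ Y (k - (j.1 : ℕ)) S x = μ • y) := by
    rintro ⟨⟨j, hjlt⟩, i⟩ _
    by_cases hj0 : j = 0
    · subst hj0
      refine Or.inr fun x ↦ ?_
      have hk' : d < k - ((⟨0, hjlt⟩ : Fin (2 + 1)) : ℕ) := by
        change d < k - 0
        omega
      obtain ⟨S, hS, hSne, hx⟩ := stub_aboveDimGenericallyZero_sharp hY hk' x
      exact ⟨S, hS, hSne, 0, by rw [nsmul_zero]; exact hx⟩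
    by_cases hj1 : j = 1
    · subst hj1
      refine Or.inr fun x ↦ ?_
      obtain ⟨S, hS, hSne, y, hy⟩ := hodd x
      exact ⟨S, hS, hSne, y, hy⟩
    · refine Or.inl ?_
      have h2 : 1 < ((⟨j, hjlt⟩ : Fin (2 + 1)) : ℕ) := by
        change 1 < j
        omega
      exact stub_aboveDimGenericallyZero_sharp hC h2 (v ⟨j, hjlt⟩ i)
  exact exists_restrictToCompl_eq_nsmul_of_gradedBasis ℤ hY hC (fun j : (Σ k, σ k) ↦ (j.1 : ℕ))
    (fun j ↦ v j.1 j.2) hv μ hyp z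

/-- **Registered sub-goal `stub_hodgeClassesGenericallyDivisible_tensorCurve_of_oddDescent` of the
crux item stmt-HodgeConjecture-18466** (crux-triage r2 harvest `PontryaginOddDescent`, product
form): for `Y` smooth projective of dimension `2p - 1` and `C` a smooth projective curve, IF every
class of `H²ᵖ⁻¹(Y(ℂ); ℤ)` is divisible by every `m ≥ 1` on the complex points of a non-empty Zariski
open of `Y`, THEN the item's conclusion holds on `X = Y ⊗ C` for every integral class (no Hodge-type
hypothesis). [cite: HatcherAT2002, §3.2 Thm. 3.16] [cite: AndreottiFrankel1959, Thm. 1] -/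
theorem stub_hodgeClassesGenericallyDivisible_tensorCurve_of_oddDescent :
    ∀ ⦃p : ℕ⦄ ⦃Y C : SchemeOver ℂ⦄, 1 ≤ p → IsSmoothProjective (2 * p - 1) Y →
      IsSmoothProjective 1 C →
      (∀ (m : ℕ) (w : singularCohomology ℤ ℤ (ComplexPoints Y) (2 * p - 1)), 1 ≤ m →
        ∃ S : Set Y.left, IsClosed S ∧ S ≠ Set.univ ∧
          ∃ y : singularCohomology ℤ ℤ (complexPointsCompl Y S) (2 * p - 1),
            m • y = singularCohomology.map ℤ ℤ
              (⟨Subtype.val, continuous_subtype_val⟩ : C(complexPointsCompl Y S, ComplexPoints Y))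
              (2 * p - 1) w) →
      ∀ z : singularCohomology ℤ ℤ
        (ComplexPoints (CategoryTheory.MonoidalCategoryStruct.tensorObj Y C)) (2 * p),
        ∀ m : ℕ, 1 ≤ m →
          ∃ Z : Set (CategoryTheory.MonoidalCategoryStruct.tensorObj Y C).left,
            IsClosed Z ∧ Z ≠ Set.univ ∧
            ∃ y : singularCohomology ℤ ℤ
              (complexPointsCompl (CategoryTheory.MonoidalCategoryStruct.tensorObj Y C) Z) (2 * p),
              m • y = singularCohomology.map ℤ ℤ
                (⟨Subtype.val, continuous_subtype_val⟩ :
                  C(complexPointsCompl (CategoryTheory.MonoidalCategoryStruct.tensorObj Y C) Z,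
                    ComplexPoints (CategoryTheory.MonoidalCategoryStruct.tensorObj Y C))) (2 * p) z := by
  intro p Y C hp hY hC hodd z m hm
  have hodd' : ∀ w : singularCohomology ℤ ℤ (ComplexPoints Y) (2 * p - 1),
      ∃ S : Set Y.left, IsClosed S ∧ S ≠ Set.univ ∧
        ∃ y : singularCohomology ℤ ℤ (complexPointsCompl Y S) (2 * p - 1),
          restrictToCompl ℤ Y (2 * p - 1) S w = m • y := by
    intro w
    obtain ⟨S, hS, hSne, y, hy⟩ := hodd m w hm
    exact ⟨S, hS, hSne, y, hy.symm⟩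
  obtain ⟨Z, hZ, hZne, w, hw⟩ := genericDivisibility_tensorCurve_of_oddDescent hY hC
    (show 2 * p - 1 < 2 * p by omega) m hodd' z
  exact ⟨Z, hZ, hZne, w, hw.symm⟩

end Summit.HodgeConjecture.HodgeConjecture.Theorems

end
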